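import Mathlib
import Summits.Ventures.Crystal3D.Theses.StickyWulffConstant
import Summits.Ventures.Crystal3D.Theorems.StickyWulffConstantStackingLiminfLayerChainV4Defs
import Summits.Ventures.Crystal3D.Theorems.StickyWulffConstantStackingLiminfModulatedWulff
import Summits.Ventures.Crystal3D.Theorems.StickyWulffConstantStackingLiminfPlateauBound
import Summits.Ventures.Crystal3D.Theorems.StickyWulffConstantStackingLiminfMollifierRegularity
import Summits.Ventures.Crystal3D.Theorems.StickyWulffConstantStackingLiminfMollifiedUpper
import HarnessLib

/-!
# The crux `StackingLiminf` (stmt-Ventures-19145) of route `StickyWulffConstant`, CLOSED by line LayerChain v4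
# "MOLLIFY, MODULATE, BRUNN–MINKOWSKI"

Cell `crystal3d-full`, venture `Summits/Ventures/Crystal3D`.  The registered skeleton of the line
(`HOME/cf-p1/route/lines/LayerChainV4.lean`, planner cf-p1 gen 13; `ledger skeleton check` OK) composes the crux
BY NAME from four stubs:
(A) `stub_modulatedWulff : ModulatedWulff` — eng g6, p506908 (`…ModulatedWulff.lean`);
(B) `stub_mollifiedUpper : MollifiedUpper` — wulff-p2 g4 + eng g6 (`…MollifiedUpper.lean`: the reduction
    `mollifiedUpper_of_skewBound`, p522162, applied to eng's skew bound `PlateauHeight.skewBound`, p525218);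
(C) `stub_plateauBound : PlateauBound` — eng g6, p519602 (`…PlateauBound.lean`);
(D) `stub_mollifierRegularity : MollifierRegularity` — wulff-p2 g3, p507104 (`…MollifierRegularity.lean`).
This file is the skeleton's composition `StackingLiminf_of_hyps` VERBATIM (parameter choice `K = δ₂ N^{1/3}`,
`L = λ N^{1/3}`, dichotomy `D ≶ 12 N^{2/3}`, `κ = 6·2^{1/3} ≤ 12`) followed by its application to the four landed
stubs: `stackingLiminf_proof : Summit.Ventures.Crystal3D.Theses.StickyWulffConstant.StackingLiminf` — for every
Hägg word `σ`, every `ε > 0` and all large `N`, every injective `N`-configuration in the Barlow stacking of `σ`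
misses at least `(6·2^{1/3} − ε) N^{2/3}` of the `6N` possible contacts (the sharp, word-uniform Wulff constant
`∛432 = 6·2^{1/3}`).
WHAT THIS IS NOT: the route's deciding theorem (the assembly `StickyWulffConstant` also needs NRG 19144 and the
liminf assembly 19146/19480–19483); rung F-C1 not moved.
-/

noncomputable section

namespace Summit.Ventures.Crystal3D.Theorems

open MeasureTheory Set Filter
open Literature.MathematicalPhysics.StatisticalMechanics (IsHaggSeq barlowStacking)
open Summit.Ventures.Crystal3D.LayerChain (dot3 stackTension stackWulff)
open Summit.Ventures.Crystal3D.Cruxes.StackingLiminf.LayerChainV4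

/-- Hypothesis form of the registered composition (skeleton `LayerChainV4.lean`, verbatim): the four stub
statements imply the UNFOLDED crux. -/
theorem stackingLiminf_of_hyps (hA : ModulatedWulff) (hB : MollifiedUpper) (hC : PlateauBound)
    (hD : MollifierRegularity) :
    ∀ ε : ℝ, 0 < ε → ∃ N₀ : ℕ, ∀ N : ℕ, N₀ ≤ N → ∀ σ : ℤ → ℤ, IsHaggSeq σ →
      ∀ x : Fin N → EuclideanSpace ℝ (Fin 3), Function.Injective x →
        (∀ i, x i ∈ barlowStacking 1 (Real.sqrt (2 / 3)) σ) →
          ((6 * (2 : ℝ) ^ ((1 : ℝ) / 3)) - ε) * (N : ℝ) ^ ((2 : ℝ) / 3) ≤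
            6 * (N : ℝ) - (Summit.Ventures.Crystal3D.numContacts x : ℝ) := by
  intro ε hε
  -- constants
  set κ : ℝ := 6 * (2 : ℝ) ^ ((1 : ℝ) / 3) with hκ_def
  have hκ12 : κ ≤ 12 := kappa_le_twelve
  have hκ0 : 0 ≤ κ := kappa_nonneg
  have hs2 : (1 : ℝ) ≤ Real.sqrt 2 := by
    rw [show (1 : ℝ) = Real.sqrt 1 by simp]
    exact Real.sqrt_le_sqrt (by norm_num)
  have hs2pos : (0 : ℝ) < Real.sqrt 2 := by positivity
  set ε₁ : ℝ := ε / 13 with hε₁_def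
  have hε₁ : 0 < ε₁ := by positivity
  -- the stubs' constants
  obtain ⟨C₀, hC₀, hB⟩ := hB
  obtain ⟨lam, hlam, K₁, N₁, hC⟩ := hC ε₁ hε₁
  -- parameter δ2 (the K/N^{1/3} ratio)
  set δ2 : ℝ := min (min lam 1) (lam * ε₁ / (24 * C₀)) with hδ2_def
  have hδ2pos : 0 < δ2 := by
    simp only [hδ2_def, lt_min_iff]
    exact ⟨⟨hlam, by norm_num⟩, by positivity⟩
  have hδ2_le_lam : δ2 ≤ lam := le_trans (min_le_left _ _) (min_le_left _ _)
  have hδ2_le : δ2 ≤ lam * ε₁ / (24 * C₀) := min_le_right _ _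
  -- threshold on t = N^{1/3}
  set T₀ : ℝ := max (max 1 K₁ / δ2) (2 * C₀ / (ε₁ * δ2 ^ 2)) with hT₀_def
  obtain ⟨N₂, hN₂f⟩ := exists_nat_cbrt_ge T₀
  refine ⟨max (max N₁ N₂) 1, ?_⟩
  intro N hN σ hσ x hx hmem
  have hN₁ : N₁ ≤ N := le_trans (le_trans (le_max_left _ _) (le_max_left _ _)) hN
  have hN₂ : N₂ ≤ N := le_trans (le_trans (le_max_right _ _) (le_max_left _ _)) hN
  have hNpos : (0 : ℝ) < (N : ℝ) := by
    have : 1 ≤ N := le_trans (le_max_right _ _) hN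
    exact_mod_cast this
  set n : ℝ := (N : ℝ) with hn_def
  set t : ℝ := n ^ ((1 : ℝ) / 3) with ht_def
  have ht0 : 0 < t := Real.rpow_pos_of_pos hNpos _
  have ht2 : t ^ 2 = n ^ ((2 : ℝ) / 3) := cbrt_sq hNpos.le
  have ht3 : t ^ 3 = n := by
    rw [ht_def, ← Real.rpow_natCast, ← Real.rpow_mul hNpos.le]; norm_num
  have hT : T₀ ≤ t := hN₂f N hN₂
  have hT1 : max 1 K₁ / δ2 ≤ t := le_trans (le_max_left _ _) hT
  have hT2 : 2 * C₀ / (ε₁ * δ2 ^ 2) ≤ t := le_trans (le_max_right _ _) hT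
  -- the scales
  set K : ℝ := δ2 * t with hK_def
  set L : ℝ := lam * t with hL_def
  have hK1 : max 1 K₁ ≤ K := by
    rw [hK_def]; rwa [div_le_iff₀ hδ2pos, mul_comm] at hT1
  have hK_one : 1 ≤ K := le_trans (le_max_left _ _) hK1
  have hK_K₁ : K₁ ≤ K := le_trans (le_max_right _ _) hK1
  have hKpos : 0 < K := lt_of_lt_of_le one_pos hK_one
  have hKL : K ≤ L := by
    rw [hK_def, hL_def]; exact mul_le_mul_of_nonneg_right hδ2_le_lam ht0.le
  have hLpos : 0 < L := lt_of_lt_of_le hKpos hKL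
  have hL_le : L ≤ lam * n ^ ((1 : ℝ) / 3) := le_rfl
  -- abbreviations
  set D : ℝ := 6 * n - (Summit.Ventures.Crystal3D.numContacts x : ℝ) with hD_def
  -- goal: (κ - ε) * n^{2/3} ≤ D
  show (κ - ε) * n ^ ((2 : ℝ) / 3) ≤ D
  rw [← ht2]
  have ht2pos : 0 < t ^ 2 := by positivity
  by_cases hcase : 12 * t ^ 2 < D
  · -- far from optimal: trivial since κ ≤ 12
    have : (κ - ε) * t ^ 2 ≤ 12 * t ^ 2 := by
      apply mul_le_mul_of_nonneg_right _ ht2pos.le; linarith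
    linarith
  · have hD12 : D ≤ 12 * t ^ 2 := not_lt.mp hcase
    have hD12' : D ≤ 12 * n ^ ((2 : ℝ) / 3) := by rwa [← ht2]
    -- regularity of the explicit mollifiers
    obtain ⟨hw2, hwc, hw0, hgc, hg01⟩ := hD N σ hσ x K L hK_one hKL
    -- (A): continuum modulated Wulff inequality
    have hAw := hA (smooth x K L) (window σ K) hw2 hwc hw0 hgc hg01
    -- (B): mollification inequality
    have hBw := hB N σ hσ x hx hmem K L hK_one hKL
    -- (C): plateau bound
    have hCw := hC N hN₁ σ hσ x hx hmem K L hK_K₁ hKL hL_le hD12'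
    rw [← ht2] at hCw
    -- error bookkeeping: C₀ (n/K² + K D / L) ≤ ε₁ t²
    have herr1 : C₀ * (n / K ^ 2) ≤ ε₁ / 2 * t ^ 2 := by
      have hK2 : K ^ 2 = δ2 ^ 2 * t ^ 2 := by rw [hK_def]; ring
      have e1 : n / K ^ 2 = t / δ2 ^ 2 := by
        rw [hK2, ← ht3]; field_simp
      rw [e1]
      -- from hT2: 2 C₀/(ε₁ δ2²) ≤ t, i.e. 2 C₀ ≤ ε₁ δ2² t
      have hd2 : 0 < δ2 ^ 2 := by positivity
      have h1 : 2 * C₀ ≤ t * (ε₁ * δ2 ^ 2) := by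
        rwa [div_le_iff₀ (by positivity)] at hT2
      rw [show C₀ * (t / δ2 ^ 2) = C₀ * t / δ2 ^ 2 by ring, div_le_iff₀ hd2]
      have h2 := mul_le_mul_of_nonneg_left h1 ht0.le
      linear_combination (1 / 2 : ℝ) * h2
    have herr2 : C₀ * (K * D / L) ≤ ε₁ / 2 * t ^ 2 := by
      have e2 : K * D / L = δ2 / lam * D := by
        rw [hK_def, hL_def]; field_simp
      rw [e2]
      have hratio : 0 ≤ δ2 / lam := by positivity
      have h1 : C₀ * (δ2 / lam * D) ≤ C₀ * (δ2 / lam * (12 * t ^ 2)) := by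
        apply mul_le_mul_of_nonneg_left _ hC₀.le
        exact mul_le_mul_of_nonneg_left hD12 hratio
      have h2 : C₀ * (δ2 / lam) ≤ ε₁ / 24 := by
        have : δ2 / lam ≤ ε₁ / (24 * C₀) := by
          rw [div_le_iff₀ hlam]
          calc δ2 ≤ lam * ε₁ / (24 * C₀) := hδ2_le
            _ = ε₁ / (24 * C₀) * lam := by ring
        calc C₀ * (δ2 / lam) ≤ C₀ * (ε₁ / (24 * C₀)) := mul_le_mul_of_nonneg_left this hC₀.le
          _ = ε₁ / 24 := by field_simp
      calc C₀ * (δ2 / lam * D) ≤ C₀ * (δ2 / lam * (12 * t ^ 2)) := h1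
        _ = (C₀ * (δ2 / lam)) * (12 * t ^ 2) := by ring
        _ ≤ (ε₁ / 24) * (12 * t ^ 2) := mul_le_mul_of_nonneg_right h2 (by positivity)
        _ = ε₁ / 2 * t ^ 2 := by ring
    have herr : C₀ * (n / K ^ 2 + K * D / L) ≤ ε₁ * t ^ 2 := by
      rw [mul_add]; linarith
    -- chain: (1-ε₁) √2 κ t² ≤ 3|W₀|^{1/3} plateau ≤ modTV ≤ √2 D + err
    have hchain : (1 - ε₁) * (Real.sqrt 2 * κ) * t ^ 2 ≤ Real.sqrt 2 * D + ε₁ * t ^ 2 := by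
      linarith
    -- conclude (κ - 13 ε₁) t² ≤ D
    have hεε : ε = 13 * ε₁ := by rw [hε₁_def]; ring
    rw [hεε]
    have hkey : Real.sqrt 2 * ((κ - 13 * ε₁) * t ^ 2) ≤ Real.sqrt 2 * D := by
      have hP : 0 ≤ ε₁ * t ^ 2 := by positivity
      have h1 : Real.sqrt 2 * κ ≤ Real.sqrt 2 * 12 := mul_le_mul_of_nonneg_left hκ12 hs2pos.le
      have h2 : Real.sqrt 2 * κ + 1 ≤ 13 * Real.sqrt 2 := by linarith
      have h3 : ε₁ * t ^ 2 * (Real.sqrt 2 * κ + 1) ≤ ε₁ * t ^ 2 * (13 * Real.sqrt 2) :=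
        mul_le_mul_of_nonneg_left h2 hP
      linear_combination hchain + h3
    exact le_of_mul_le_mul_left hkey hs2pos


/-- **The crux `StackingLiminf` (stmt-Ventures-19145), proved**: the registered composition applied to the four
landed stubs (A) p506908, (B) `stub_mollifiedUpper`, (C) p519602, (D) p507104. -/
theorem StackingLiminf_proof : Summit.Ventures.Crystal3D.Theses.StickyWulffConstant.StackingLiminf :=
  stackingLiminf_of_hyps stub_modulatedWulff stub_mollifiedUpper stub_plateauBound stub_mollifierRegularity

end Summit.Ventures.Crystal3D.Theorems

end
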